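/-
Origin: expansion seat `prover-pub-hodgecm-mc-carch-1-g36-0`, handover #CA66 2026-08-21T01:50Z md5 9b60c5e6e4d3 (316 l.; NEW additive leaf; imports Model.ArchKTypeOfDefiniteChar34 + Model.ArchKTypeOfSlotRecChar34; ns HodgeCM.Model; 6 theorems 0 defs; NAMES for audit: HodgeCM.Model.harch_two_of_defType_tmulG · HodgeCM.Model.harm_lineOmega_twoG · HodgeCM.Model.harm_lineOmega_threeG) (`HOME/mc/pub-hodgecm-mc-carch-1/stage69/HodgeCM/Model/ArchKTypeOfDist34.lean`, md5 9b60c5e6e4d3, 316 lines);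
landed by the gen-29 packager (p-g29) in gate run 69 as `HodgeCM/Model/ArchKTypeOfDist34.lean` (verbatim).
-/
/-
Copyright (c) 2026 the pub-hodgecm formalisation cell (harness21).  New file, not vendored.
Origin: session prover-pub-hodgecm-mc-carch-1-g36-0 (unit pub-hodgecm-mc-carch-1, C / ARCHDATUM BUILDER gen 36; SLOTS 2 AND 3 of the (J4) input:
the line-2/3 clone of #CA61 `Model/ArchKTypeOfDist` for sinst-1's `thetaDistDatumTwoOf/ThreeOf` (#1258), binder-1 PLANNING NOTE «SLOTS 2 AND 3»), 2026-08-21.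
Intended final place: `HodgeCM/Model/ArchKTypeOfDist34.lean` (NEW additive model-layer leaf; imports installed carch #CA44 `Model/ArchKTypeOfDefiniteChar34`
+ #W28 `Model/ArchKTypeOfSlotRecChar34`; nothing imports it; drop alone).
-/
import Summits.HodgeConjecture.HodgeCM.Model.ArchKTypeOfDefiniteChar34
import Summits.HodgeConjecture.HodgeCM.Model.ArchKTypeOfSlotRecChar34

/-!
# (c5) at the operator level and the `K_∞`-harmonicity of the honest family — LINES 2 AND 3 (conjugated plane)

The line-2/3 twin of #CA61 `Model/ArchKTypeOfDist` (lines 0/1), for sinst-1's slot-2/3 product Weil data `thetaDistDatumTwoOf/ThreeOf`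
(#1258 `Model/AdelicThetaDistributionOf34`, fields `Φarch/harm/hdef` in #1250's currency with `lineOmega_two/three … hGR hGR₂ hGR₃ η₂/η₃`):

* § 1 **`smul_cmArchWeilRep_blockFamilyOfAt_eq_self_two/threeG`** (archimedean (c5) core under #CA44's hypotheses `hω`/`hdef` of
  `harch_two/three_of_defTypeG`, verbatim) and **`harch_two/three_of_defType_tmulG`** (= the `hdef` field of the slot-2/3 datum at
  `lineRepOf … 2/3`, for EVERY `ℓ` and EVERY finite vector; #CA44 `lineRepOf_two/three_regime_archToAdelicG` + tree `adelicTensorEnd_apply_tmul`);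
* § 2 **`harm_lineOmega_two/threeG hemb eR eS hχ u ℓ`** (= the `harm` field: #CA13 `smulPull_blockFamilyOfAt_harm` with `hsec`
  (`hsec_of_embedding_eq hemb`), `(K)` (#W28 `cmBlockRepAt_κ_tensorPi_lineVacExponentsTwo/Three` — the conjugated lines' sign facts are
  HYPOTHESIS-FREE, `lineSign_two/three`) and `hΦ₁` (`unitaryOpPi_dualPairι_degOnePDual Empty`) discharged; one input left: (χ)₂/(χ)₃ `hχ`
  (pin: #CA55 `…R2Family`)).

Nothing is cited and nothing is minted: kernel lemmas over installed carch modules; 0 records, 0 `def … : Prop`, 0 defs.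
-/

set_option autoImplicit false

noncomputable section

open NumberField NumberField.InfinitePlace NumberField.mixedEmbedding IsDedekindDomain
open scoped Matrix TensorProduct Classical SchwartzMap
open MvPolynomial
open MulAction
open Literature.Geometry.ComplexHyperbolic.BallModel (U21 x₀ stabilizerEquivK21)
open Literature.NumberTheory.Automorphic.U21 (K21 matA sclD)
open Literature.AlgebraicGeometry.HodgeTheory
open Literature.AlgebraicGeometry.ShimuraVarieties Literature.AlgebraicGeometry.ShimuraVarieties.BallForms
open Literature.NumberTheory.Automorphic Literature.NumberTheory.Automorphic.UnitaryGroup Literature.NumberTheory.Weil1964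
open Literature.RepresentationTheory.KonnoKonno2007 Literature.RepresentationTheory.KonnoKonno2007.RealDualPair
open Literature.NumberTheory.GelbartRogawski1991 Literature.NumberTheory.GelbartRogawski1991.UnitaryDualPair
open Literature.RepresentationTheory (atPlace)
open Literature.Analysis.SegalBargmann
open HodgeCM.Adelic HodgeCM.PerL34 HodgeCM.Model.HypCensus HodgeCM.Model.SupplyInstance HodgeCM.Model.ArchSideTerm

namespace HodgeCM.Model

/-! ### § 1. (c5) at the operator level: the archimedean core and the pure-tensor form -/

section DefTypeTmul34

variable {L : CMField} {ι₁ : L →+* ℂ} (V : HermSpace3 L ι₁) (S : StubTree.SeesawDatum L)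
variable
  (hGR : (cmSplittingDatum (L : Type) finProdFinEquiv (frameD V) (frameD_real V) (frameD_ne V) (dW S) (dW_real S) (dW_ne S)).CompatibleSplitting)
  (hGR₀ : (cmSplittingDatum (L : Type) (e₁) (frameD V) (frameD_real V) (frameD_ne V) (lineVec (L : Type) (dW S 0))
    (fun _ => dW_real S 0) (fun _ => dW_ne S 0)).CompatibleSplitting)
  (hGR₁ : (cmSplittingDatum (L : Type) (e₁) (frameD V) (frameD_real V) (frameD_ne V) (lineVec (L : Type) (dW S 1))
    (fun _ => dW_real S 1) (fun _ => dW_ne S 1)).CompatibleSplitting)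
  (hGR₂ : (cmSplittingDatum (L : Type) (e₁) (frameD V) (frameD_real V) (frameD_ne V) (lineVec (L : Type) (dW' S 0))
    (fun _ => dW'_real S 0) (fun _ => dW'_ne S 0)).CompatibleSplitting)
  (hGR₃ : (cmSplittingDatum (L : Type) (e₁) (frameD V) (frameD_real V) (frameD_ne V) (lineVec (L : Type) (dW' S 1))
    (fun _ => dW'_real S 1) (fun _ => dW'_ne S 1)).CompatibleSplitting)
  (η₀ η₁ η₂ η₃ : CMAdelic (L : Type) (frameD V) × CMAdelicOne (L : Type) →* ℂˣ)
  (hV : IsAnisotropic L V.Hm)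

variable {S' : Type} [Fintype S'] [DecidableEq S']
  (eR : PosIdx (cmXW (L : Type) (frameD V) (lineVec (L : Type) (dW' S 0)) (fun _ => dW'_real S 0) ι₁ (HypCensus.cmPlace (L : Type) ι₁)) ≃ Unit)
  (eS : NegIdx (cmXW (L : Type) (frameD V) (lineVec (L : Type) (dW' S 0)) (fun _ => dW'_real S 0) ι₁ (HypCensus.cmPlace (L : Type) ι₁)) ≃ S')
  (eR₃ : PosIdx (cmXW (L : Type) (frameD V) (lineVec (L : Type) (dW' S 1)) (fun _ => dW'_real S 1) ι₁ (HypCensus.cmPlace (L : Type) ι₁)) ≃ Unit)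
  (eS₃ : NegIdx (cmXW (L : Type) (frameD V) (lineVec (L : Type) (dW' S 1)) (fun _ => dW'_real S 1) ι₁ (HypCensus.cmPlace (L : Type) ι₁)) ≃ S')

/-- **(c5) for line 2, ARCHIMEDEAN CORE**: an archimedean `a ∈ U(V.Hm)(L ⊗ ℝ)` trivial at `w(ι₁)` fixes every member of the line's slot family
under `c₂(a′) • ω_∞,2(a′, 1)` — from the exponent table `hω` and the definite type `hdef` of the line scalar (#CA44's hypotheses, verbatim). -/
theorem smul_cmArchWeilRep_blockFamilyOfAt_eq_self_twoG
    (a : {v : InfinitePlace ↥(maximalRealSubfield L) // v.IsReal} → ℤ)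
    (hω : ∀ b : {v : InfinitePlace ↥(maximalRealSubfield L) // v.IsReal}, b ≠ HypCensus.cmPlace (L : Type) ι₁ →
      ∀ (u : UnitaryGroup.archLocal (L : Type) 3 (Matrix.diagonal (frameD V)) (cmPlaceOver (L : Type) b)) (ℓ : Module.Dual ℂ (Fin 2 → ℂ)),
        cmArchWeilRep (L : Type) e₁ (frameD V) (frameD_real V) (frameD_ne V) (lineVec (L : Type) (dW' S 0)) (fun _ => dW'_real S 0)
            (fun _ => dW'_ne S 0) hGR₂
            (UnitaryGroup.archSingle (↥(maximalRealSubfield L)) L (IsCMField.complexConj L) 3 (Matrix.diagonal (frameD V))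
              (IsCMField.complexConj_ne_one L) (NumberField.complexConj_smul_infinitePlace (L : Type)) (cmPlaceOver (L : Type) b) u, 1)
            (blockFamilyOfAt (L : Type) e₁ (frameD V) (frameD_real V) (frameD_ne V) (lineVec (L : Type) (dW' S 0)) (fun _ => dW'_real S 0)
              (fun _ => dW'_ne S 0) ι₁ (blockPosEquiv V) (blockNegEquiv V) eR eS (degOnePDual S') (binvPi 1) ℓ) =
          (((u : UnitaryGroup.archLocal (L : Type) 3 (Matrix.diagonal (frameD V)) (cmPlaceOver (L : Type) b)) : GL (Fin 3) ℂ) :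
              Matrix (Fin 3) (Fin 3) ℂ).det ^ a b •
            blockFamilyOfAt (L : Type) e₁ (frameD V) (frameD_real V) (frameD_ne V) (lineVec (L : Type) (dW' S 0)) (fun _ => dW'_real S 0)
              (fun _ => dW'_ne S 0) ι₁ (blockPosEquiv V) (blockNegEquiv V) eR eS (degOnePDual S') (binvPi 1) ℓ)
    (hdef : ∀ b : {v : InfinitePlace ↥(maximalRealSubfield L) // v.IsReal}, b ≠ HypCensus.cmPlace (L : Type) ι₁ →
      ∀ u : UnitaryGroup.archLocal (L : Type) 3 (Matrix.diagonal (frameD V)) (cmPlaceOver (L : Type) b),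
        ((archScalar_twoG V S hGR hGR₂ hGR₃ η₂
            (UnitaryGroup.archSingle (↥(maximalRealSubfield L)) L (IsCMField.complexConj L) 3 (Matrix.diagonal (frameD V))
              (IsCMField.complexConj_ne_one L) (NumberField.complexConj_smul_infinitePlace (L : Type)) (cmPlaceOver (L : Type) b) u) : ℂˣ) : ℂ) *
          (((u : UnitaryGroup.archLocal (L : Type) 3 (Matrix.diagonal (frameD V)) (cmPlaceOver (L : Type) b)) : GL (Fin 3) ℂ) :
              Matrix (Fin 3) (Fin 3) ℂ).det ^ a b = 1) :
    ∀ aa : UnitaryGroup.arch (↥(maximalRealSubfield L)) L (IsCMField.complexConj L) 3 V.Hm,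
      UnitaryGroup.archAt (↥(maximalRealSubfield L)) L (IsCMField.complexConj L) 3 V.Hm (UnitaryGroup.cmPlace (L : Type) ι₁)
          (NumberField.complexConj_smul_infinitePlace (L : Type) _) (IsCMField.complexConj_ne_one (L : Type)) aa = 1 →
      ∀ ℓ : Module.Dual ℂ (Fin 2 → ℂ),
        ((archScalar_twoG V S hGR hGR₂ hGR₃ η₂ (archFrameCongr (L : Type) V.Hm (frameG V) (frameD V) (frame_congr V) aa) : ℂˣ) : ℂ) •
            cmArchWeilRep (L : Type) e₁ (frameD V) (frameD_real V) (frameD_ne V) (lineVec (L : Type) (dW' S 0)) (fun _ => dW'_real S 0)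
              (fun _ => dW'_ne S 0) hGR₂ (archFrameCongr (L : Type) V.Hm (frameG V) (frameD V) (frame_congr V) aa, 1)
              (blockFamilyOfAt (L : Type) e₁ (frameD V) (frameD_real V) (frameD_ne V) (lineVec (L : Type) (dW' S 0)) (fun _ => dW'_real S 0)
              (fun _ => dW'_ne S 0) ι₁ (blockPosEquiv V) (blockNegEquiv V) eR eS (degOnePDual S') (binvPi 1) ℓ) =
          blockFamilyOfAt (L : Type) e₁ (frameD V) (frameD_real V) (frameD_ne V) (lineVec (L : Type) (dW' S 0)) (fun _ => dW'_real S 0)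
              (fun _ => dW'_ne S 0) ι₁ (blockPosEquiv V) (blockNegEquiv V) eR eS (degOnePDual S') (binvPi 1) ℓ := by
  intro aa haa ℓ
  have h := smul_apply_eq_self_of_places (L : Type) (Matrix.diagonal (frameD V))
    ((cmArchWeilRep (L : Type) e₁ (frameD V) (frameD_real V) (frameD_ne V) (lineVec (L : Type) (dW' S 0)) (fun _ => dW'_real S 0)
      (fun _ => dW'_ne S 0) hGR₂).comp (MonoidHom.inl _ _))
    (archScalar_twoG V S hGR hGR₂ hGR₃ η₂)
    (blockFamilyOfAt (L : Type) e₁ (frameD V) (frameD_real V) (frameD_ne V) (lineVec (L : Type) (dW' S 0)) (fun _ => dW'_real S 0)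
      (fun _ => dW'_ne S 0) ι₁ (blockPosEquiv V) (blockNegEquiv V) eR eS (degOnePDual S') (binvPi 1) ℓ)
    (UnitaryGroup.cmPlace (L : Type) ι₁) (fun b hb u => by
      rw [MonoidHom.comp_apply, MonoidHom.inl_apply, hω b (ne_cmPlace_of_cmPlaceOver_ne hb) u ℓ, smul_smul,
        hdef b (ne_cmPlace_of_cmPlaceOver_ne hb) u, one_smul])
    (archFrameCongr (L : Type) V.Hm (frameG V) (frameD V) (frame_congr V) aa) (archAt_archFrameCongr_eq_one V haa)
  rw [MonoidHom.comp_apply, MonoidHom.inl_apply] at h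
  exact h

/-- **(c5) for line 2 AT THE OPERATOR LEVEL, FOR EVERY FINITE VECTOR**: `lineRepOf 2 ((a)^𝔸_regime, 1) (Φ_∞,2(ℓ) ⊗ Φ_f) = Φ_∞,2(ℓ) ⊗ Φ_f`
— sinst-1's `ThetaDistDatum.hdef` for slot 2 at `lineRepOf` (#CA44 `harch_two_of_defTypeG` with `testFun (Φ ℓ) x₀ N` replaced by the pure tensor). -/
theorem harch_two_of_defType_tmulG
    (a : {v : InfinitePlace ↥(maximalRealSubfield L) // v.IsReal} → ℤ)
    (hω : ∀ b : {v : InfinitePlace ↥(maximalRealSubfield L) // v.IsReal}, b ≠ HypCensus.cmPlace (L : Type) ι₁ →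
      ∀ (u : UnitaryGroup.archLocal (L : Type) 3 (Matrix.diagonal (frameD V)) (cmPlaceOver (L : Type) b)) (ℓ : Module.Dual ℂ (Fin 2 → ℂ)),
        cmArchWeilRep (L : Type) e₁ (frameD V) (frameD_real V) (frameD_ne V) (lineVec (L : Type) (dW' S 0)) (fun _ => dW'_real S 0)
            (fun _ => dW'_ne S 0) hGR₂
            (UnitaryGroup.archSingle (↥(maximalRealSubfield L)) L (IsCMField.complexConj L) 3 (Matrix.diagonal (frameD V))
              (IsCMField.complexConj_ne_one L) (NumberField.complexConj_smul_infinitePlace (L : Type)) (cmPlaceOver (L : Type) b) u, 1)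
            (blockFamilyOfAt (L : Type) e₁ (frameD V) (frameD_real V) (frameD_ne V) (lineVec (L : Type) (dW' S 0)) (fun _ => dW'_real S 0)
              (fun _ => dW'_ne S 0) ι₁ (blockPosEquiv V) (blockNegEquiv V) eR eS (degOnePDual S') (binvPi 1) ℓ) =
          (((u : UnitaryGroup.archLocal (L : Type) 3 (Matrix.diagonal (frameD V)) (cmPlaceOver (L : Type) b)) : GL (Fin 3) ℂ) :
              Matrix (Fin 3) (Fin 3) ℂ).det ^ a b •
            blockFamilyOfAt (L : Type) e₁ (frameD V) (frameD_real V) (frameD_ne V) (lineVec (L : Type) (dW' S 0)) (fun _ => dW'_real S 0)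
              (fun _ => dW'_ne S 0) ι₁ (blockPosEquiv V) (blockNegEquiv V) eR eS (degOnePDual S') (binvPi 1) ℓ)
    (hdef : ∀ b : {v : InfinitePlace ↥(maximalRealSubfield L) // v.IsReal}, b ≠ HypCensus.cmPlace (L : Type) ι₁ →
      ∀ u : UnitaryGroup.archLocal (L : Type) 3 (Matrix.diagonal (frameD V)) (cmPlaceOver (L : Type) b),
        ((archScalar_twoG V S hGR hGR₂ hGR₃ η₂
            (UnitaryGroup.archSingle (↥(maximalRealSubfield L)) L (IsCMField.complexConj L) 3 (Matrix.diagonal (frameD V))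
              (IsCMField.complexConj_ne_one L) (NumberField.complexConj_smul_infinitePlace (L : Type)) (cmPlaceOver (L : Type) b) u) : ℂˣ) : ℂ) *
          (((u : UnitaryGroup.archLocal (L : Type) 3 (Matrix.diagonal (frameD V)) (cmPlaceOver (L : Type) b)) : GL (Fin 3) ℂ) :
              Matrix (Fin 3) (Fin 3) ℂ).det ^ a b = 1) :
    ∀ aa : UnitaryGroup.arch (↥(maximalRealSubfield L)) L (IsCMField.complexConj L) 3 V.Hm,
      UnitaryGroup.archAt (↥(maximalRealSubfield L)) L (IsCMField.complexConj L) 3 V.Hm (UnitaryGroup.cmPlace (L : Type) ι₁)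
          (NumberField.complexConj_smul_infinitePlace (L : Type) _) (IsCMField.complexConj_ne_one (L : Type)) aa = 1 →
      ∀ (ℓ : Module.Dual ℂ (Fin 2 → ℂ)) (Φf : FinSB (↥(maximalRealSubfield L)) (Fin 3)),
        lineRepOf V S hGR hGR₀ hGR₁ hGR₂ hGR₃ η₀ η₁ η₂ η₃ 2
            (HodgeCM.Adelic.regimeEquiv L V.Hm hV
              (UnitaryGroup.archToAdelic (↥(maximalRealSubfield L)) L (IsCMField.complexConj L) 3 V.Hm aa), 1)
            (piSchwartzBruhatEquiv (↥(maximalRealSubfield L)) (Fin 3)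
              (blockFamilyOfAt (L : Type) e₁ (frameD V) (frameD_real V) (frameD_ne V) (lineVec (L : Type) (dW' S 0)) (fun _ => dW'_real S 0)
              (fun _ => dW'_ne S 0) ι₁ (blockPosEquiv V) (blockNegEquiv V) eR eS (degOnePDual S') (binvPi 1) ℓ ⊗ₜ[ℂ] Φf)) =
          piSchwartzBruhatEquiv (↥(maximalRealSubfield L)) (Fin 3)
            (blockFamilyOfAt (L : Type) e₁ (frameD V) (frameD_real V) (frameD_ne V) (lineVec (L : Type) (dW' S 0)) (fun _ => dW'_real S 0)
              (fun _ => dW'_ne S 0) ι₁ (blockPosEquiv V) (blockNegEquiv V) eR eS (degOnePDual S') (binvPi 1) ℓ ⊗ₜ[ℂ] Φf) := by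
  intro aa haa ℓ Φf
  rw [lineRepOf_two_regime_archToAdelicG V S hGR hGR₀ hGR₁ hGR₂ hGR₃ η₀ η₁ η₂ η₃ hV aa, adelicTensorEnd_apply_tmul, LinearMap.smul_apply,
    LinearMap.id_apply, smul_cmArchWeilRep_blockFamilyOfAt_eq_self_twoG (V := V) (S := S) (hGR := hGR) (hGR₂ := hGR₂) (hGR₃ := hGR₃)
      (η₂ := η₂) (eR := eR) (eS := eS) (a := a) (hω := hω) (hdef := hdef) aa haa ℓ]

/-- **(c5) for line 3, ARCHIMEDEAN CORE**. -/
theorem smul_cmArchWeilRep_blockFamilyOfAt_eq_self_threeG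
    (a : {v : InfinitePlace ↥(maximalRealSubfield L) // v.IsReal} → ℤ)
    (hω : ∀ b : {v : InfinitePlace ↥(maximalRealSubfield L) // v.IsReal}, b ≠ HypCensus.cmPlace (L : Type) ι₁ →
      ∀ (u : UnitaryGroup.archLocal (L : Type) 3 (Matrix.diagonal (frameD V)) (cmPlaceOver (L : Type) b)) (ℓ : Module.Dual ℂ (Fin 2 → ℂ)),
        cmArchWeilRep (L : Type) e₁ (frameD V) (frameD_real V) (frameD_ne V) (lineVec (L : Type) (dW' S 1)) (fun _ => dW'_real S 1)
            (fun _ => dW'_ne S 1) hGR₃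
            (UnitaryGroup.archSingle (↥(maximalRealSubfield L)) L (IsCMField.complexConj L) 3 (Matrix.diagonal (frameD V))
              (IsCMField.complexConj_ne_one L) (NumberField.complexConj_smul_infinitePlace (L : Type)) (cmPlaceOver (L : Type) b) u, 1)
            (blockFamilyOfAt (L : Type) e₁ (frameD V) (frameD_real V) (frameD_ne V) (lineVec (L : Type) (dW' S 1)) (fun _ => dW'_real S 1)
              (fun _ => dW'_ne S 1) ι₁ (blockPosEquiv V) (blockNegEquiv V) eR₃ eS₃ (degOnePDual S') (binvPi 1) ℓ) =
          (((u : UnitaryGroup.archLocal (L : Type) 3 (Matrix.diagonal (frameD V)) (cmPlaceOver (L : Type) b)) : GL (Fin 3) ℂ) :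
              Matrix (Fin 3) (Fin 3) ℂ).det ^ a b •
            blockFamilyOfAt (L : Type) e₁ (frameD V) (frameD_real V) (frameD_ne V) (lineVec (L : Type) (dW' S 1)) (fun _ => dW'_real S 1)
              (fun _ => dW'_ne S 1) ι₁ (blockPosEquiv V) (blockNegEquiv V) eR₃ eS₃ (degOnePDual S') (binvPi 1) ℓ)
    (hdef : ∀ b : {v : InfinitePlace ↥(maximalRealSubfield L) // v.IsReal}, b ≠ HypCensus.cmPlace (L : Type) ι₁ →
      ∀ u : UnitaryGroup.archLocal (L : Type) 3 (Matrix.diagonal (frameD V)) (cmPlaceOver (L : Type) b),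
        ((archScalar_threeG V S hGR hGR₂ hGR₃ η₃
            (UnitaryGroup.archSingle (↥(maximalRealSubfield L)) L (IsCMField.complexConj L) 3 (Matrix.diagonal (frameD V))
              (IsCMField.complexConj_ne_one L) (NumberField.complexConj_smul_infinitePlace (L : Type)) (cmPlaceOver (L : Type) b) u) : ℂˣ) : ℂ) *
          (((u : UnitaryGroup.archLocal (L : Type) 3 (Matrix.diagonal (frameD V)) (cmPlaceOver (L : Type) b)) : GL (Fin 3) ℂ) :
              Matrix (Fin 3) (Fin 3) ℂ).det ^ a b = 1) :
    ∀ aa : UnitaryGroup.arch (↥(maximalRealSubfield L)) L (IsCMField.complexConj L) 3 V.Hm,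
      UnitaryGroup.archAt (↥(maximalRealSubfield L)) L (IsCMField.complexConj L) 3 V.Hm (UnitaryGroup.cmPlace (L : Type) ι₁)
          (NumberField.complexConj_smul_infinitePlace (L : Type) _) (IsCMField.complexConj_ne_one (L : Type)) aa = 1 →
      ∀ ℓ : Module.Dual ℂ (Fin 2 → ℂ),
        ((archScalar_threeG V S hGR hGR₂ hGR₃ η₃ (archFrameCongr (L : Type) V.Hm (frameG V) (frameD V) (frame_congr V) aa) : ℂˣ) : ℂ) •
            cmArchWeilRep (L : Type) e₁ (frameD V) (frameD_real V) (frameD_ne V) (lineVec (L : Type) (dW' S 1)) (fun _ => dW'_real S 1)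
              (fun _ => dW'_ne S 1) hGR₃ (archFrameCongr (L : Type) V.Hm (frameG V) (frameD V) (frame_congr V) aa, 1)
              (blockFamilyOfAt (L : Type) e₁ (frameD V) (frameD_real V) (frameD_ne V) (lineVec (L : Type) (dW' S 1)) (fun _ => dW'_real S 1)
              (fun _ => dW'_ne S 1) ι₁ (blockPosEquiv V) (blockNegEquiv V) eR₃ eS₃ (degOnePDual S') (binvPi 1) ℓ) =
          blockFamilyOfAt (L : Type) e₁ (frameD V) (frameD_real V) (frameD_ne V) (lineVec (L : Type) (dW' S 1)) (fun _ => dW'_real S 1)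
              (fun _ => dW'_ne S 1) ι₁ (blockPosEquiv V) (blockNegEquiv V) eR₃ eS₃ (degOnePDual S') (binvPi 1) ℓ := by
  intro aa haa ℓ
  have h := smul_apply_eq_self_of_places (L : Type) (Matrix.diagonal (frameD V))
    ((cmArchWeilRep (L : Type) e₁ (frameD V) (frameD_real V) (frameD_ne V) (lineVec (L : Type) (dW' S 1)) (fun _ => dW'_real S 1)
      (fun _ => dW'_ne S 1) hGR₃).comp (MonoidHom.inl _ _))
    (archScalar_threeG V S hGR hGR₂ hGR₃ η₃)
    (blockFamilyOfAt (L : Type) e₁ (frameD V) (frameD_real V) (frameD_ne V) (lineVec (L : Type) (dW' S 1)) (fun _ => dW'_real S 1)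
      (fun _ => dW'_ne S 1) ι₁ (blockPosEquiv V) (blockNegEquiv V) eR₃ eS₃ (degOnePDual S') (binvPi 1) ℓ)
    (UnitaryGroup.cmPlace (L : Type) ι₁) (fun b hb u => by
      rw [MonoidHom.comp_apply, MonoidHom.inl_apply, hω b (ne_cmPlace_of_cmPlaceOver_ne hb) u ℓ, smul_smul,
        hdef b (ne_cmPlace_of_cmPlaceOver_ne hb) u, one_smul])
    (archFrameCongr (L : Type) V.Hm (frameG V) (frameD V) (frame_congr V) aa) (archAt_archFrameCongr_eq_one V haa)
  rw [MonoidHom.comp_apply, MonoidHom.inl_apply] at h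
  exact h

/-- **(c5) for line 3 AT THE OPERATOR LEVEL, FOR EVERY FINITE VECTOR** — sinst-1's `ThetaDistDatum.hdef` for slot 3 at `lineRepOf`. -/
theorem harch_three_of_defType_tmulG
    (a : {v : InfinitePlace ↥(maximalRealSubfield L) // v.IsReal} → ℤ)
    (hω : ∀ b : {v : InfinitePlace ↥(maximalRealSubfield L) // v.IsReal}, b ≠ HypCensus.cmPlace (L : Type) ι₁ →
      ∀ (u : UnitaryGroup.archLocal (L : Type) 3 (Matrix.diagonal (frameD V)) (cmPlaceOver (L : Type) b)) (ℓ : Module.Dual ℂ (Fin 2 → ℂ)),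
        cmArchWeilRep (L : Type) e₁ (frameD V) (frameD_real V) (frameD_ne V) (lineVec (L : Type) (dW' S 1)) (fun _ => dW'_real S 1)
            (fun _ => dW'_ne S 1) hGR₃
            (UnitaryGroup.archSingle (↥(maximalRealSubfield L)) L (IsCMField.complexConj L) 3 (Matrix.diagonal (frameD V))
              (IsCMField.complexConj_ne_one L) (NumberField.complexConj_smul_infinitePlace (L : Type)) (cmPlaceOver (L : Type) b) u, 1)
            (blockFamilyOfAt (L : Type) e₁ (frameD V) (frameD_real V) (frameD_ne V) (lineVec (L : Type) (dW' S 1)) (fun _ => dW'_real S 1)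
              (fun _ => dW'_ne S 1) ι₁ (blockPosEquiv V) (blockNegEquiv V) eR₃ eS₃ (degOnePDual S') (binvPi 1) ℓ) =
          (((u : UnitaryGroup.archLocal (L : Type) 3 (Matrix.diagonal (frameD V)) (cmPlaceOver (L : Type) b)) : GL (Fin 3) ℂ) :
              Matrix (Fin 3) (Fin 3) ℂ).det ^ a b •
            blockFamilyOfAt (L : Type) e₁ (frameD V) (frameD_real V) (frameD_ne V) (lineVec (L : Type) (dW' S 1)) (fun _ => dW'_real S 1)
              (fun _ => dW'_ne S 1) ι₁ (blockPosEquiv V) (blockNegEquiv V) eR₃ eS₃ (degOnePDual S') (binvPi 1) ℓ)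
    (hdef : ∀ b : {v : InfinitePlace ↥(maximalRealSubfield L) // v.IsReal}, b ≠ HypCensus.cmPlace (L : Type) ι₁ →
      ∀ u : UnitaryGroup.archLocal (L : Type) 3 (Matrix.diagonal (frameD V)) (cmPlaceOver (L : Type) b),
        ((archScalar_threeG V S hGR hGR₂ hGR₃ η₃
            (UnitaryGroup.archSingle (↥(maximalRealSubfield L)) L (IsCMField.complexConj L) 3 (Matrix.diagonal (frameD V))
              (IsCMField.complexConj_ne_one L) (NumberField.complexConj_smul_infinitePlace (L : Type)) (cmPlaceOver (L : Type) b) u) : ℂˣ) : ℂ) *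
          (((u : UnitaryGroup.archLocal (L : Type) 3 (Matrix.diagonal (frameD V)) (cmPlaceOver (L : Type) b)) : GL (Fin 3) ℂ) :
              Matrix (Fin 3) (Fin 3) ℂ).det ^ a b = 1) :
    ∀ aa : UnitaryGroup.arch (↥(maximalRealSubfield L)) L (IsCMField.complexConj L) 3 V.Hm,
      UnitaryGroup.archAt (↥(maximalRealSubfield L)) L (IsCMField.complexConj L) 3 V.Hm (UnitaryGroup.cmPlace (L : Type) ι₁)
          (NumberField.complexConj_smul_infinitePlace (L : Type) _) (IsCMField.complexConj_ne_one (L : Type)) aa = 1 →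
      ∀ (ℓ : Module.Dual ℂ (Fin 2 → ℂ)) (Φf : FinSB (↥(maximalRealSubfield L)) (Fin 3)),
        lineRepOf V S hGR hGR₀ hGR₁ hGR₂ hGR₃ η₀ η₁ η₂ η₃ 3
            (HodgeCM.Adelic.regimeEquiv L V.Hm hV
              (UnitaryGroup.archToAdelic (↥(maximalRealSubfield L)) L (IsCMField.complexConj L) 3 V.Hm aa), 1)
            (piSchwartzBruhatEquiv (↥(maximalRealSubfield L)) (Fin 3)
              (blockFamilyOfAt (L : Type) e₁ (frameD V) (frameD_real V) (frameD_ne V) (lineVec (L : Type) (dW' S 1)) (fun _ => dW'_real S 1)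
              (fun _ => dW'_ne S 1) ι₁ (blockPosEquiv V) (blockNegEquiv V) eR₃ eS₃ (degOnePDual S') (binvPi 1) ℓ ⊗ₜ[ℂ] Φf)) =
          piSchwartzBruhatEquiv (↥(maximalRealSubfield L)) (Fin 3)
            (blockFamilyOfAt (L : Type) e₁ (frameD V) (frameD_real V) (frameD_ne V) (lineVec (L : Type) (dW' S 1)) (fun _ => dW'_real S 1)
              (fun _ => dW'_ne S 1) ι₁ (blockPosEquiv V) (blockNegEquiv V) eR₃ eS₃ (degOnePDual S') (binvPi 1) ℓ ⊗ₜ[ℂ] Φf) := by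
  intro aa haa ℓ Φf
  rw [lineRepOf_three_regime_archToAdelicG V S hGR hGR₀ hGR₁ hGR₂ hGR₃ η₀ η₁ η₂ η₃ hV aa, adelicTensorEnd_apply_tmul, LinearMap.smul_apply,
    LinearMap.id_apply, smul_cmArchWeilRep_blockFamilyOfAt_eq_self_threeG (V := V) (S := S) (hGR := hGR) (hGR₂ := hGR₂) (hGR₃ := hGR₃)
      (η₃ := η₃) (eR₃ := eR₃) (eS₃ := eS₃) (a := a) (hω := hω) (hdef := hdef) aa haa ℓ]

end DefTypeTmul34

/-! ### § 2. (W-K∞′) for the honest archimedean factors `lineOmega_two/three` on the slot family, pin-discharged -/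

section Harm34

variable {L : CMField} {ι₁ : L →+* ℂ} (V : HermSpace3 L ι₁) (c : SeesawCtx L)
variable
  (hGR : (cmSplittingDatum (L : Type) finProdFinEquiv (frameD V) (frameD_real V) (frameD_ne V) (dW c.D) (dW_real c.D)
    (dW_ne c.D)).CompatibleSplitting)
  (hGR₂ : (cmSplittingDatum (L : Type) (e₁) (frameD V) (frameD_real V) (frameD_ne V) (lineVec (L : Type) (dW' c.D 0))
    (fun _ => dW'_real c.D 0) (fun _ => dW'_ne c.D 0)).CompatibleSplitting)
  (hGR₃ : (cmSplittingDatum (L : Type) (e₁) (frameD V) (frameD_real V) (frameD_ne V) (lineVec (L : Type) (dW' c.D 1))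
    (fun _ => dW'_real c.D 1) (fun _ => dW'_ne c.D 1)).CompatibleSplitting)
  (η₂ η₃ : CMAdelic (L : Type) (frameD V) × CMAdelicOne (L : Type) →* ℂˣ)
  (Φ₂ : SchwartzMap ((Fin 3 × {v : {v : InfinitePlace ↥(maximalRealSubfield L) // v.IsReal} // v ≠ HypCensus.cmPlace (L : Type) ι₁}) → ℝ) ℂ)

/-- **(W-K∞′) for line 2 — `harm` of the (J4) datum at `lineOmega_two`**: the `ι₁`-archimedean factor acts on the slot family
`ℓ ↦ blockFamilyOfAt … eR eS (degOnePDual Empty) Φ₂ ℓ` through `τ₁^∨ = (weightOf x₀)^∨` on `Stab(x₀)`; #CA13 `smulPull_blockFamilyOfAt_harm` with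
`hsec` (canonical representative `hemb`), `(K)` (#W28, exponent tuple of record, sign facts hypothesis-free) and `hΦ₁` discharged — the one input left is (χ)₂ `hχ`. -/
theorem harm_lineOmega_twoG (hemb : (InfinitePlace.mk ι₁).embedding = ι₁)
    (eR : PosIdx (cmXW (L : Type) (frameD V) (lineVec (L : Type) (dW' c.D 0)) (fun _ => dW'_real c.D 0) ι₁ (HypCensus.cmPlace (L : Type) ι₁)) ≃ Unit)
    (eS : NegIdx (cmXW (L : Type) (frameD V) (lineVec (L : Type) (dW' c.D 0)) (fun _ => dW'_real c.D 0) ι₁ (HypCensus.cmPlace (L : Type) ι₁)) ≃ Empty)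
    (hχ : ∀ u : stabilizer U21 x₀,
      ((lineScalar_two V c.D hGR hGR₂ hGR₃ η₂ (u : U21) : ℂˣ) : ℂ) *
          ((matA (stabilizerEquivK21.symm u)).det ^ (lineVacExponentsTwo V c hGR₂ eR eS).eP *
            sclD (stabilizerEquivK21.symm u) ^ (lineVacExponentsTwo V c hGR₂ eR eS).eQ) =
        star (sclD (stabilizerEquivK21.symm u)))
    (u : stabilizer U21 x₀) (ℓ : Module.Dual ℂ (Fin 2 → ℂ)) :
    lineOmega_two V c.D hGR hGR₂ hGR₃ η₂ (u : U21)
        (blockFamilyOfAt (L : Type) e₁ (frameD V) (frameD_real V) (frameD_ne V) (lineVec (L : Type) (dW' c.D 0)) (fun _ => dW'_real c.D 0)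
          (fun _ => dW'_ne c.D 0) ι₁ (blockPosEquiv V) (blockNegEquiv V) eR eS (degOnePDual Empty) Φ₂ ℓ) =
      blockFamilyOfAt (L : Type) e₁ (frameD V) (frameD_real V) (frameD_ne V) (lineVec (L : Type) (dW' c.D 0)) (fun _ => dW'_real c.D 0)
        (fun _ => dW'_ne c.D 0) ι₁ (blockPosEquiv V) (blockNegEquiv V) eR eS (degOnePDual Empty) Φ₂
        ((isPullbackCocycle_cotangentCocycle.weightOf x₀).dual u ℓ) :=
  smulPull_blockFamilyOfAt_harm V e₁ (lineVec (L : Type) (dW' c.D 0)) (fun _ => dW'_real c.D 0) (fun _ => dW'_ne c.D 0) hGR₂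
    (lineScalar_two V c.D hGR hGR₂ hGR₃ η₂) eR eS (degOnePDual Empty) Φ₂
    (hsec_of_embedding_eq V (lineVec (L : Type) (dW' c.D 0)) (fun _ => dW'_real c.D 0) (fun _ => dW'_ne c.D 0) _ _ hemb)
    (fun kk Φ => cmBlockRepAt_κ_tensorPi_lineVacExponentsTwo V c hGR₂ eR eS kk Φ Φ₂)
    (unitaryOpPi_dualPairι_degOnePDual Empty) hχ u ℓ

/-- **(W-K∞′) for line 3 — `harm` of the (J4) datum at `lineOmega_three`**; the one input left is (χ)₃ `hχ`. -/
theorem harm_lineOmega_threeG (hemb : (InfinitePlace.mk ι₁).embedding = ι₁)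
    (eR : PosIdx (cmXW (L : Type) (frameD V) (lineVec (L : Type) (dW' c.D 1)) (fun _ => dW'_real c.D 1) ι₁ (HypCensus.cmPlace (L : Type) ι₁)) ≃ Unit)
    (eS : NegIdx (cmXW (L : Type) (frameD V) (lineVec (L : Type) (dW' c.D 1)) (fun _ => dW'_real c.D 1) ι₁ (HypCensus.cmPlace (L : Type) ι₁)) ≃ Empty)
    (hχ : ∀ u : stabilizer U21 x₀,
      ((lineScalar_three V c.D hGR hGR₂ hGR₃ η₃ (u : U21) : ℂˣ) : ℂ) *
          ((matA (stabilizerEquivK21.symm u)).det ^ (lineVacExponentsThree V c hGR₃ eR eS).eP *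
            sclD (stabilizerEquivK21.symm u) ^ (lineVacExponentsThree V c hGR₃ eR eS).eQ) =
        star (sclD (stabilizerEquivK21.symm u)))
    (u : stabilizer U21 x₀) (ℓ : Module.Dual ℂ (Fin 2 → ℂ)) :
    lineOmega_three V c.D hGR hGR₂ hGR₃ η₃ (u : U21)
        (blockFamilyOfAt (L : Type) e₁ (frameD V) (frameD_real V) (frameD_ne V) (lineVec (L : Type) (dW' c.D 1)) (fun _ => dW'_real c.D 1)
          (fun _ => dW'_ne c.D 1) ι₁ (blockPosEquiv V) (blockNegEquiv V) eR eS (degOnePDual Empty) Φ₂ ℓ) =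
      blockFamilyOfAt (L : Type) e₁ (frameD V) (frameD_real V) (frameD_ne V) (lineVec (L : Type) (dW' c.D 1)) (fun _ => dW'_real c.D 1)
        (fun _ => dW'_ne c.D 1) ι₁ (blockPosEquiv V) (blockNegEquiv V) eR eS (degOnePDual Empty) Φ₂
        ((isPullbackCocycle_cotangentCocycle.weightOf x₀).dual u ℓ) :=
  smulPull_blockFamilyOfAt_harm V e₁ (lineVec (L : Type) (dW' c.D 1)) (fun _ => dW'_real c.D 1) (fun _ => dW'_ne c.D 1) hGR₃
    (lineScalar_three V c.D hGR hGR₂ hGR₃ η₃) eR eS (degOnePDual Empty) Φ₂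
    (hsec_of_embedding_eq V (lineVec (L : Type) (dW' c.D 1)) (fun _ => dW'_real c.D 1) (fun _ => dW'_ne c.D 1) _ _ hemb)
    (fun kk Φ => cmBlockRepAt_κ_tensorPi_lineVacExponentsThree V c hGR₃ eR eS kk Φ Φ₂)
    (unitaryOpPi_dualPairι_degOnePDual Empty) hχ u ℓ

end Harm34

end HodgeCM.Model

end
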